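import Summits.CriticalPhenomena.PercolationContinuityZ3.Theorems.FK.FreeWiredCoincidence
import Summits.CriticalPhenomena.PercolationContinuityZ3.Theorems.FK.UniquenessCriticalFKIsing
import HarnessLib

/-!
# FK-continuity cell, FO-10a: box measures with an ARBITRARY wired boundary class `B ⊆ ∂Λ_N` — the sandwich
# `φ⁰_{Λ_N} ≤ φ^B_{Λ_N} ≤ φ¹_{Λ_N}` (Grimmett 2006, Lemma (4.14)(b), eq. (4.21)) and UNIQUENESS `φ⁰_{p,q} = φ¹_{p,q}`
# IFF INSENSITIVITY TO THE BOUNDARY WIRING (Grimmett's (4.36) `|W_{p,q}| = 1 ⟺ φ⁰ = φ¹` in the tree's vocabulary)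

Registered R104 (cell INBOX l.7098, 2026-08-24); registry row FO-10a-g340; label BCW-A (coordinator fk-4 g217).
Cell `fk-continuity` (bschramm), row FO-10a (domain-Markov + boundary-condition comparison layer over FO-06); support file
for the FK-continuity transplant (`--supports stmt-CriticalPhenomena-4575`); builds on p205010 (kernel theorem, internal
audit signed; external expert review pending). Pure proofs; no definitions, no named facts, no sorries; general `d`.
UNCONDITIONAL finite- and infinite-volume structure; it decides nothing about FH / TP_FK / the value of `p_c(q)`.

The tree's infinite-volume random-cluster measures `φ^b_{p,q} = rcLimit d b p q` are the limits of the box measures with the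
two EXTREME boundary conditions, `b = false` (free, nothing wired) and `b = true` (the whole inner vertex boundary `∂Λ_N`
wired into one class, `boxBC d true N`). The Literature's finite-volume measure `rcMeasure G p q B` allows any ONE wired
class `B`; for the boxes `Λ_N = [-N,N]^d` and any `B ⊆ ∂Λ_N` (a boundary condition between free and wired: Grimmett's
`φ^ξ_{Λ,p,q}` for the external configurations `ξ` whose open clusters meet `∂Λ` in at most one class) this file proves,
for `0 ≤ p ≤ 1`, `q ≥ 1`, with `φ^B_{Λ_N}(A)` read as `(rcMeasure (finsetGraph (zdGraph d) (box d N)) p q B).real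
(liftEdges (box d N) ⁻¹' A)` (edges off `Λ_N` closed, as for `rcBoxLaw`):

* §1 **finite-volume sandwich** (Lemma (4.14)(b), monotonicity in the wired set, Literature
  `rcMeasure_real_mono_wired_of_isUpperSet`): `φ⁰_{Λ_N}(A) ≤ φ^B_{Λ_N}(A) ≤ φ¹_{Λ_N}(A)` for increasing `A`
  (`rcBoxLaw_false_real_le_rcMeasure_real`, `rcMeasure_real_le_rcBoxLaw_true_real`), reversed for decreasing `A`;
* §2 **limits** (eq. (4.21) for these boundary conditions): along ANY sequence of wirings `B_N ⊆ ∂Λ_N` and for every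
  increasing local event `A`, `φ⁰_{p,q}(A) ≤ liminf_N φ^{B_N}_{Λ_N}(A) ≤ limsup_N φ^{B_N}_{Λ_N}(A) ≤ φ¹_{p,q}(A)`
  (`rcLimit_false_real_le_liminf`, `limsup_le_rcLimit_true_real`), hence `φ^{B_N}_{Λ_N}(A) → φ⁰_{p,q}(A)` whenever
  `φ⁰_{p,q}(A) = φ¹_{p,q}(A)` (`tendsto_rcMeasure_real_of_rcLimit_real_eq`, and the decreasing twin);
* §3 **uniqueness iff boundary-wiring insensitivity**: `φ⁰_{p,q} = φ¹_{p,q}` iff for EVERY sequence of wirings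
  `B_N ⊆ ∂Λ_N` and EVERY local event `A` (monotone or not — inclusion–exclusion, FO-06 `InfiniteVolumeCylinders`, and the
  identification of the limit measure on the increasing cylinders) `φ^{B_N}_{Λ_N}(A) → φ⁰_{p,q}(A)`
  (**`tendsto_rcMeasure_real_of_rcLimit_eq`**, **`rcLimit_false_eq_rcLimit_true_iff_forall_wiring`**); this holds
  whenever `θ¹(p,q) = 0`, throughout the subcritical phase `p < p_c(q)`, at `p_c(q)` under the cell's wired target
  `FKContinuityWired d q` (FO-10a `UniquenessOfNonPercolationTheta`; `tendsto_rcMeasure_real_of_thetaWired_eq_zero`,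
  `…_of_lt_rcCriticalProb`, `…_rcCriticalProb_of_fkContinuityWired`), for all
  but countably many `p` (Thm. (4.60), FO-07b `FreeWiredCoincidence`; `countable_setOf_not_forall_wiring_tendsto`) and —
  by Aizenman–Duminil-Copin–Sidoravicius 2015 through FO-10a `rcLimit_false_eq_rcLimit_true_rcCriticalProb_two` — **at the
  critical point of the FK–Ising model on `ℤ^d`, `d ≥ 3`: the critical finite-volume FK–Ising measures converge to the
  unique critical state WHATEVER the boundary wirings** (**`tendsto_rcMeasure_real_rcCriticalProb_two`**, and at
  `p = 1 - e^{-2β_c(d)}`).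

Honest framing: infinite-volume bookkeeping for the boundary conditions expressible in the tree (ONE wired class; Grimmett's
general `ξ` wires a PARTITION of `∂Λ` and is not a tree notion); no statement about `p_c(q)`; the `q = 2` clause is a
COROLLARY of the in-tree ADS chain (as `UniquenessCriticalFKIsing`), not upstream of any `T_F(2)` / `T_W(2)` statement;
NOT a binder discharge, NOT `_r4`. Companion file: `BoundaryWiringEdgeDensity.lean` (Grimmett's (4.74)–(4.76) for every wiring).

## References

* G. Grimmett, *The Random-Cluster Model*, Springer 2006 (`book:grimmett2006-random-cluster-model`): Lemma (4.14)(b),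
  Thm. (4.19)(a),(c) eq. (4.21), (4.36), Thm. (4.60), Thm. (4.63) [PDF pp. 74–78, 82, 89–92]; Conj. (5.34)(ii). [Grimmett2006]
* M. Aizenman, H. Duminil-Copin, V. Sidoravicius, Comm. Math. Phys. 334 (2015) 719–742, Thm. 1.2, Cor. 1.5(1).
  [AizenmanDuminilCopinSidoraviciusCMP2015]
-/

noncomputable section

open MeasureTheory Set Filter Finset
open scoped Topology ENNReal

namespace Summit.CriticalPhenomena.PercolationContinuityZ3.Theorems.FK

open Literature.Probability.Percolation Literature.Probability.LatticeModels
open Literature.Barriers.CriticalPhenomena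

variable {d : ℕ} {p q : ℝ}

/-! ### §1 The finite-volume sandwich `φ⁰_{Λ_N} ≤ φ^B_{Λ_N} ≤ φ¹_{Λ_N}` for `B ⊆ ∂Λ_N` -/

section Finite

/-- **Free ≤ any wiring** on increasing events of the box: `φ⁰_{Λ_N,p,q}(A) ≤ φ^B_{Λ_N,p,q}(A)` for every wired class
`B` (`0 ≤ p ≤ 1`, `q ≥ 1`). [cite: Grimmett2006, Lemma (4.14)(b)] -/
theorem rcBoxMeasure_false_real_le_rcMeasure_real (hp : p ∈ Set.Icc (0 : ℝ) 1) (hq : 1 ≤ q) {N : ℕ}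
    (B : Set ↥(box d N)) {A : Set (BondConfig ↥(box d N))} (hA : IsUpperSet A) :
    (rcBoxMeasure d false p q N).real A ≤ (rcMeasure (finsetGraph (zdGraph d) (box d N)) p q B).real A := by
  rw [rcBoxMeasure_false]
  exact rcMeasure_real_mono_wired_of_isUpperSet _ hp hq (Set.empty_subset _) hA

/-- **Any boundary wiring ≤ wired** on increasing events of the box: `φ^B_{Λ_N,p,q}(A) ≤ φ¹_{Λ_N,p,q}(A)` for every
wired class `B ⊆ ∂Λ_N` (`0 ≤ p ≤ 1`, `q ≥ 1`). [cite: Grimmett2006, Lemma (4.14)(b)] -/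
theorem rcMeasure_real_le_rcBoxMeasure_true_real (hp : p ∈ Set.Icc (0 : ℝ) 1) (hq : 1 ≤ q) {N : ℕ}
    {B : Set ↥(box d N)} (hB : B ⊆ boxBC d true N) {A : Set (BondConfig ↥(box d N))} (hA : IsUpperSet A) :
    (rcMeasure (finsetGraph (zdGraph d) (box d N)) p q B).real A ≤ (rcBoxMeasure d true p q N).real A := by
  rw [rcBoxMeasure_true]
  exact rcMeasure_real_mono_wired_of_isUpperSet _ hp hq hB hA

/-- The same read on events of `ℤ^d` (edges off `Λ_N` closed): `φ⁰_{Λ_N}(A) ≤ φ^B_{Λ_N}(A)` for increasing measurable `A`.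
[cite: Grimmett2006, Lemma (4.14)(b)] -/
theorem rcBoxLaw_false_real_le_rcMeasure_real (hp : p ∈ Set.Icc (0 : ℝ) 1) (hq : 1 ≤ q) {N : ℕ}
    (B : Set ↥(box d N)) {A : Set (BondConfig (Site d))} (hA : IsUpperSet A) (hAm : MeasurableSet A) :
    (rcBoxLaw d false p q N).real A ≤
      (rcMeasure (finsetGraph (zdGraph d) (box d N)) p q B).real (liftEdges (box d N) ⁻¹' A) := by
  rw [rcBoxLaw_real_apply _ _ _ _ hAm]
  exact rcBoxMeasure_false_real_le_rcMeasure_real hp hq B (hA.preimage (liftEdges_mono _))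

/-- … and `φ^B_{Λ_N}(A) ≤ φ¹_{Λ_N}(A)` for `B ⊆ ∂Λ_N` and increasing measurable `A`. [cite: Grimmett2006, Lemma (4.14)(b)] -/
theorem rcMeasure_real_le_rcBoxLaw_true_real (hp : p ∈ Set.Icc (0 : ℝ) 1) (hq : 1 ≤ q) {N : ℕ}
    {B : Set ↥(box d N)} (hB : B ⊆ boxBC d true N) {A : Set (BondConfig (Site d))} (hA : IsUpperSet A)
    (hAm : MeasurableSet A) :
    (rcMeasure (finsetGraph (zdGraph d) (box d N)) p q B).real (liftEdges (box d N) ⁻¹' A) ≤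
      (rcBoxLaw d true p q N).real A := by
  rw [rcBoxLaw_real_apply _ _ _ _ hAm]
  exact rcMeasure_real_le_rcBoxMeasure_true_real hp hq hB (hA.preimage (liftEdges_mono _))

/-- Decreasing dual: `φ^B_{Λ_N}(D) ≤ φ⁰_{Λ_N}(D)` for decreasing measurable `D`. [cite: Grimmett2006, Lemma (4.14)(b)] -/
theorem rcMeasure_real_le_rcBoxLaw_false_real_of_isLowerSet (hp : p ∈ Set.Icc (0 : ℝ) 1) (hq : 1 ≤ q) {N : ℕ}
    (B : Set ↥(box d N)) {D : Set (BondConfig (Site d))} (hD : IsLowerSet D) (hDm : MeasurableSet D) :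
    (rcMeasure (finsetGraph (zdGraph d) (box d N)) p q B).real (liftEdges (box d N) ⁻¹' D) ≤
      (rcBoxLaw d false p q N).real D := by
  have hq0 : 0 < q := one_pos.trans_le hq
  haveI := isProbabilityMeasure_rcMeasure (finsetGraph (zdGraph d) (box d N)) hp hq0 B
  haveI := isProbabilityMeasure_rcBoxLaw (d := d) false hp hq0 N
  have h := rcBoxLaw_false_real_le_rcMeasure_real hp hq B hD.compl hDm.compl
  rw [Set.preimage_compl, probReal_compl_eq_one_sub hDm,
    probReal_compl_eq_one_sub (μ := rcMeasure (finsetGraph (zdGraph d) (box d N)) p q B) MeasurableSet.of_discrete] at h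
  linarith

/-- Decreasing dual: `φ¹_{Λ_N}(D) ≤ φ^B_{Λ_N}(D)` for `B ⊆ ∂Λ_N` and decreasing measurable `D`.
[cite: Grimmett2006, Lemma (4.14)(b)] -/
theorem rcBoxLaw_true_real_le_rcMeasure_real_of_isLowerSet (hp : p ∈ Set.Icc (0 : ℝ) 1) (hq : 1 ≤ q) {N : ℕ}
    {B : Set ↥(box d N)} (hB : B ⊆ boxBC d true N) {D : Set (BondConfig (Site d))} (hD : IsLowerSet D)
    (hDm : MeasurableSet D) :
    (rcBoxLaw d true p q N).real D ≤
      (rcMeasure (finsetGraph (zdGraph d) (box d N)) p q B).real (liftEdges (box d N) ⁻¹' D) := by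
  have hq0 : 0 < q := one_pos.trans_le hq
  haveI := isProbabilityMeasure_rcMeasure (finsetGraph (zdGraph d) (box d N)) hp hq0 B
  haveI := isProbabilityMeasure_rcBoxLaw (d := d) true hp hq0 N
  have h := rcMeasure_real_le_rcBoxLaw_true_real hp hq hB hD.compl hDm.compl
  rw [Set.preimage_compl, probReal_compl_eq_one_sub hDm,
    probReal_compl_eq_one_sub (μ := rcMeasure (finsetGraph (zdGraph d) (box d N)) p q B) MeasurableSet.of_discrete] at h
  linarith

end Finite

/-! ### §2 Limits along an arbitrary sequence of boundary wirings `B_N ⊆ ∂Λ_N` -/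

section Limit

/-- The finite-volume probabilities `φ^{B_N}_{Λ_N}(A)` lie in `[0,1]`: bounded above … [folklore] -/
theorem isBoundedUnder_le_rcMeasure_real (hp : p ∈ Set.Icc (0 : ℝ) 1) (hq : 1 ≤ q) (B : ∀ N : ℕ, Set ↥(box d N))
    (A : Set (BondConfig (Site d))) :
    IsBoundedUnder (· ≤ ·) atTop
      (fun N => (rcMeasure (finsetGraph (zdGraph d) (box d N)) p q (B N)).real (liftEdges (box d N) ⁻¹' A)) := by
  refine isBoundedUnder_of ⟨1, fun N => ?_⟩
  haveI := isProbabilityMeasure_rcMeasure (finsetGraph (zdGraph d) (box d N)) hp (one_pos.trans_le hq) (B N)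
  exact measureReal_le_one

/-- … and bounded below. [folklore] -/
theorem isBoundedUnder_ge_rcMeasure_real (B : ∀ N : ℕ, Set ↥(box d N)) (A : Set (BondConfig (Site d))) :
    IsBoundedUnder (· ≥ ·) atTop
      (fun N => (rcMeasure (finsetGraph (zdGraph d) (box d N)) p q (B N)).real (liftEdges (box d N) ⁻¹' A)) :=
  isBoundedUnder_of ⟨0, fun _ => measureReal_nonneg⟩

/-- **`φ⁰_{p,q}(A) ≤ liminf_N φ^{B_N}_{Λ_N,p,q}(A)`** for every increasing local event `A` and EVERY sequence of wired
classes `B_N` (`0 ≤ p ≤ 1`, `q ≥ 1`). [cite: Grimmett2006, Thm. (4.19)(c) eq. (4.21)] -/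
theorem rcLimit_false_real_le_liminf (hp : p ∈ Set.Icc (0 : ℝ) 1) (hq : 1 ≤ q) (B : ∀ N : ℕ, Set ↥(box d N))
    {A : Set (BondConfig (Site d))} (hA : IsLocalEvent A) (hAu : IsUpperSet A) :
    (rcLimit d false p q).real A ≤
      liminf (fun N => (rcMeasure (finsetGraph (zdGraph d) (box d N)) p q (B N)).real (liftEdges (box d N) ⁻¹' A))
        atTop := by
  have hAm : MeasurableSet A := measurableSet_of_isLocalEvent_holds hA
  rw [← ((isBoxLimit_rcLimit false hp hq).tendsto_real hA).liminf_eq]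
  refine liminf_le_liminf (Eventually.of_forall fun N => rcBoxLaw_false_real_le_rcMeasure_real hp hq (B N) hAu hAm)
    (isBoundedUnder_of ⟨0, fun _ => measureReal_nonneg⟩) ?_
  exact (isBoundedUnder_le_rcMeasure_real hp hq B A).isCoboundedUnder_ge

/-- **`limsup_N φ^{B_N}_{Λ_N,p,q}(A) ≤ φ¹_{p,q}(A)`** for every increasing local event `A` and every sequence of wired
classes `B_N ⊆ ∂Λ_N` (`0 ≤ p ≤ 1`, `q ≥ 1`). [cite: Grimmett2006, Thm. (4.19)(c) eq. (4.21)] -/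
theorem limsup_le_rcLimit_true_real (hp : p ∈ Set.Icc (0 : ℝ) 1) (hq : 1 ≤ q) {B : ∀ N : ℕ, Set ↥(box d N)}
    (hB : ∀ N, B N ⊆ boxBC d true N) {A : Set (BondConfig (Site d))} (hA : IsLocalEvent A) (hAu : IsUpperSet A) :
    limsup (fun N => (rcMeasure (finsetGraph (zdGraph d) (box d N)) p q (B N)).real (liftEdges (box d N) ⁻¹' A))
        atTop ≤ (rcLimit d true p q).real A := by
  have hAm : MeasurableSet A := measurableSet_of_isLocalEvent_holds hA
  rw [← ((isBoxLimit_rcLimit true hp hq).tendsto_real hA).limsup_eq]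
  refine limsup_le_limsup (Eventually.of_forall fun N => rcMeasure_real_le_rcBoxLaw_true_real hp hq (hB N) hAu hAm)
    ?_ ?_
  · exact (isBoundedUnder_ge_rcMeasure_real B A).isCoboundedUnder_le
  · refine isBoundedUnder_of ⟨1, fun N => ?_⟩
    haveI := isProbabilityMeasure_rcBoxLaw (d := d) true hp (one_pos.trans_le hq) N
    exact measureReal_le_one

/-- **Squeeze**: if `φ⁰_{p,q}(A) = φ¹_{p,q}(A)` for an increasing local event `A`, then `φ^{B_N}_{Λ_N,p,q}(A) → φ⁰_{p,q}(A)`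
along EVERY sequence of boundary wirings `B_N ⊆ ∂Λ_N`. [cite: Grimmett2006, Thm. (4.19)(c) eq. (4.21) with (4.36)] -/
theorem tendsto_rcMeasure_real_of_rcLimit_real_eq (hp : p ∈ Set.Icc (0 : ℝ) 1) (hq : 1 ≤ q)
    {B : ∀ N : ℕ, Set ↥(box d N)} (hB : ∀ N, B N ⊆ boxBC d true N) {A : Set (BondConfig (Site d))}
    (hA : IsLocalEvent A) (hAu : IsUpperSet A) (h : (rcLimit d false p q).real A = (rcLimit d true p q).real A) :
    Tendsto (fun N => (rcMeasure (finsetGraph (zdGraph d) (box d N)) p q (B N)).real (liftEdges (box d N) ⁻¹' A))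
      atTop (𝓝 ((rcLimit d false p q).real A)) := by
  have hAm : MeasurableSet A := measurableSet_of_isLocalEvent_holds hA
  have h₀ := (isBoxLimit_rcLimit false hp hq).tendsto_real hA
  have h₁ := (isBoxLimit_rcLimit true hp hq).tendsto_real hA
  rw [← h] at h₁
  exact tendsto_of_tendsto_of_tendsto_of_le_of_le h₀ h₁
    (fun N => rcBoxLaw_false_real_le_rcMeasure_real hp hq (B N) hAu hAm)
    (fun N => rcMeasure_real_le_rcBoxLaw_true_real hp hq (hB N) hAu hAm)

/-- Decreasing version of the squeeze: if `φ⁰_{p,q}(D) = φ¹_{p,q}(D)` for a decreasing local event `D`, then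
`φ^{B_N}_{Λ_N,p,q}(D) → φ⁰_{p,q}(D)` along every `B_N ⊆ ∂Λ_N`. [cite: Grimmett2006, Thm. (4.19)(c) eq. (4.21) with (4.36)] -/
theorem tendsto_rcMeasure_real_of_rcLimit_real_eq_of_isLowerSet (hp : p ∈ Set.Icc (0 : ℝ) 1) (hq : 1 ≤ q)
    {B : ∀ N : ℕ, Set ↥(box d N)} (hB : ∀ N, B N ⊆ boxBC d true N) {D : Set (BondConfig (Site d))}
    (hD : IsLocalEvent D) (hDl : IsLowerSet D) (h : (rcLimit d false p q).real D = (rcLimit d true p q).real D) :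
    Tendsto (fun N => (rcMeasure (finsetGraph (zdGraph d) (box d N)) p q (B N)).real (liftEdges (box d N) ⁻¹' D))
      atTop (𝓝 ((rcLimit d false p q).real D)) := by
  have hDm : MeasurableSet D := measurableSet_of_isLocalEvent_holds hD
  have h₀ := (isBoxLimit_rcLimit false hp hq).tendsto_real hD
  have h₁ := (isBoxLimit_rcLimit true hp hq).tendsto_real hD
  rw [← h] at h₁
  exact tendsto_of_tendsto_of_tendsto_of_le_of_le h₁ h₀
    (fun N => rcBoxLaw_true_real_le_rcMeasure_real_of_isLowerSet hp hq (hB N) hDl hDm)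
    (fun N => rcMeasure_real_le_rcBoxLaw_false_real_of_isLowerSet hp hq (B N) hDl hDm)

end Limit

/-! ### §3 Uniqueness `φ⁰_{p,q} = φ¹_{p,q}` iff insensitivity to the boundary wiring -/

section Unique

/-- **At a point of uniqueness every boundary wiring gives the same local limit**: if `φ⁰_{p,q} = φ¹_{p,q}` then
`φ^{B_N}_{Λ_N,p,q}(A) → φ⁰_{p,q}(A)` for EVERY local event `A` (monotone or not) and EVERY sequence of wired classes
`B_N ⊆ ∂Λ_N` (`0 ≤ p ≤ 1`, `q ≥ 1`). Increasing cylinders by the squeeze, all local events by inclusion–exclusion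
(`InfiniteVolumeCylinders`) and the identification of the limit measure on the increasing cylinders.
[cite: Grimmett2006, (4.36) with Thm. (4.19)(a),(c)] -/
theorem tendsto_rcMeasure_real_of_rcLimit_eq (hp : p ∈ Set.Icc (0 : ℝ) 1) (hq : 1 ≤ q)
    (huniq : rcLimit d false p q = rcLimit d true p q) {B : ∀ N : ℕ, Set ↥(box d N)}
    (hB : ∀ N, B N ⊆ boxBC d true N) {A : Set (BondConfig (Site d))} (hA : IsLocalEvent A) :
    Tendsto (fun N => (rcMeasure (finsetGraph (zdGraph d) (box d N)) p q (B N)).real (liftEdges (box d N) ⁻¹' A))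
      atTop (𝓝 ((rcLimit d false p q).real A)) := by
  have hq0 : 0 < q := one_pos.trans_le hq
  -- the laws on `ℤ^d`
  set ν : ℕ → Measure (BondConfig (Site d)) :=
    fun N => (rcMeasure (finsetGraph (zdGraph d) (box d N)) p q (B N)).map (liftEdges (box d N)) with hν
  have hνprob : ∀ N, IsProbabilityMeasure (ν N) := fun N => by
    haveI := isProbabilityMeasure_rcMeasure (finsetGraph (zdGraph d) (box d N)) hp hq0 (B N)
    exact Measure.isProbabilityMeasure_map (measurable_liftEdges (box d N)).aemeasurable
  have hνreal : ∀ N {A' : Set (BondConfig (Site d))}, MeasurableSet A' →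
      (ν N).real A' = (rcMeasure (finsetGraph (zdGraph d) (box d N)) p q (B N)).real (liftEdges (box d N) ⁻¹' A') :=
    fun N A' hA' => by rw [hν, map_measureReal_apply (measurable_liftEdges (box d N)) hA']
  -- increasing cylinders converge to `φ⁰`
  have hcyl : ∀ E₀ : Finset (Sym2 (Site d)),
      Tendsto (fun N => (ν N).real {ω | (↑E₀ : Set (Sym2 (Site d))) ⊆ ω}) atTop
        (𝓝 ((rcLimit d false p q).real {ω | (↑E₀ : Set (Sym2 (Site d))) ⊆ ω})) := fun E₀ => by
    have hloc : IsLocalEvent {ω : BondConfig (Site d) | (↑E₀ : Set (Sym2 (Site d))) ⊆ ω} := ⟨_, determinedBy_setOf_subset E₀⟩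
    have hAu : IsUpperSet {ω : BondConfig (Site d) | (↑E₀ : Set (Sym2 (Site d))) ⊆ ω} :=
      fun ω ω' hle hω => Set.Subset.trans hω hle
    refine (tendsto_rcMeasure_real_of_rcLimit_real_eq hp hq hB hloc hAu (by rw [huniq])).congr fun N => ?_
    rw [hνreal N (measurableSet_of_isLocalEvent_holds hloc)]
  -- a limit measure on all local events, identified with `φ⁰` on the increasing cylinders
  haveI := hνprob
  obtain ⟨P, hPprob, hP⟩ := exists_measure_tendsto_of_tendsto_supset ν fun E₀ => ⟨_, hcyl E₀⟩
  haveI := hPprob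
  haveI := isProbabilityMeasure_rcLimit false p q (d := d)
  have hPeq : P = rcLimit d false p q := by
    refine ext_of_setOf_subset fun E₀ => ?_
    have hloc : IsLocalEvent {ω : BondConfig (Site d) | (↑E₀ : Set (Sym2 (Site d))) ⊆ ω} := ⟨_, determinedBy_setOf_subset E₀⟩
    have h1 : Tendsto (fun N => (ν N).real {ω | (↑E₀ : Set (Sym2 (Site d))) ⊆ ω}) atTop
        (𝓝 (P.real {ω | (↑E₀ : Set (Sym2 (Site d))) ⊆ ω})) :=
      (ENNReal.tendsto_toReal (measure_ne_top P _)).comp (hP _ hloc)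
    have h2 := tendsto_nhds_unique h1 (hcyl E₀)
    exact (ENNReal.toReal_eq_toReal_iff' (measure_ne_top _ _) (measure_ne_top _ _)).1 h2
  subst hPeq
  have h := (ENNReal.tendsto_toReal (measure_ne_top (rcLimit d false p q) A)).comp (hP A hA)
  refine h.congr fun N => ?_
  simp only [Function.comp]
  rw [← measureReal_def, hνreal N (measurableSet_of_isLocalEvent_holds hA)]

/-- **Uniqueness iff boundary-wiring insensitivity** (Grimmett's `|W_{p,q}| = 1 ⟺ φ⁰_{p,q} = φ¹_{p,q}`, for the boundary
conditions of the tree): `φ⁰_{p,q} = φ¹_{p,q}` iff along every sequence of wired classes `B_N ⊆ ∂Λ_N` and for every local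
event `A`, `φ^{B_N}_{Λ_N,p,q}(A) → φ⁰_{p,q}(A)` (`0 ≤ p ≤ 1`, `q ≥ 1`). [cite: Grimmett2006, (4.36) with Thm. (4.19)(c) eq. (4.21)] -/
theorem rcLimit_false_eq_rcLimit_true_iff_forall_wiring (hp : p ∈ Set.Icc (0 : ℝ) 1) (hq : 1 ≤ q) :
    rcLimit d false p q = rcLimit d true p q ↔
      ∀ B : ∀ N : ℕ, Set ↥(box d N), (∀ N, B N ⊆ boxBC d true N) → ∀ A : Set (BondConfig (Site d)), IsLocalEvent A →
        Tendsto (fun N => (rcMeasure (finsetGraph (zdGraph d) (box d N)) p q (B N)).real (liftEdges (box d N) ⁻¹' A))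
          atTop (𝓝 ((rcLimit d false p q).real A)) := by
  refine ⟨fun h B hB A hA => tendsto_rcMeasure_real_of_rcLimit_eq hp hq h hB hA, fun h => ?_⟩
  -- the wired wiring `B_N = ∂Λ_N` converges to `φ¹` and, by hypothesis, to `φ⁰`
  haveI := isProbabilityMeasure_rcLimit false p q (d := d)
  haveI := isProbabilityMeasure_rcLimit true p q (d := d)
  refine ext_of_setOf_subset fun E₀ => ?_
  have hloc : IsLocalEvent {ω : BondConfig (Site d) | (↑E₀ : Set (Sym2 (Site d))) ⊆ ω} := ⟨_, determinedBy_setOf_subset E₀⟩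
  have hAm := measurableSet_of_isLocalEvent_holds hloc
  have h0 := h (fun N => boxBC d true N) (fun N => Subset.rfl) _ hloc
  have h1 : Tendsto (fun N => (rcMeasure (finsetGraph (zdGraph d) (box d N)) p q (boxBC d true N)).real
      (liftEdges (box d N) ⁻¹' {ω | (↑E₀ : Set (Sym2 (Site d))) ⊆ ω})) atTop
      (𝓝 ((rcLimit d true p q).real {ω | (↑E₀ : Set (Sym2 (Site d))) ⊆ ω})) := by
    refine ((isBoxLimit_rcLimit true hp hq).tendsto_real hloc).congr fun N => ?_
    rw [rcBoxLaw_real_apply _ _ _ _ hAm, rcBoxMeasure_true]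
    rfl
  have h2 := tendsto_nhds_unique h0 h1
  exact (ENNReal.toReal_eq_toReal_iff' (measure_ne_top _ _) (measure_ne_top _ _)).1 h2

/-- **Non-percolating wired phase**: if `θ¹(p,q) = 0` then `φ⁰_{p,q} = φ¹_{p,q}` (FO-10a `UniquenessOfNonPercolationTheta`,
Grimmett's Thm. (5.33)(a)) and hence every sequence of boundary wirings `B_N ⊆ ∂Λ_N` gives the same local limit `φ⁰_{p,q}`.
[cite: Grimmett2006, Thm. (5.33)(a) with (4.36)] -/
theorem tendsto_rcMeasure_real_of_thetaWired_eq_zero (hp : p ∈ Set.Icc (0 : ℝ) 1) (hq : 1 ≤ q)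
    (hθ : thetaWired d p q = 0) {B : ∀ N : ℕ, Set ↥(box d N)} (hB : ∀ N, B N ⊆ boxBC d true N)
    {A : Set (BondConfig (Site d))} (hA : IsLocalEvent A) :
    Tendsto (fun N => (rcMeasure (finsetGraph (zdGraph d) (box d N)) p q (B N)).real (liftEdges (box d N) ⁻¹' A))
      atTop (𝓝 ((rcLimit d false p q).real A)) :=
  tendsto_rcMeasure_real_of_rcLimit_eq hp hq (rcLimit_false_eq_rcLimit_true_of_thetaWired_eq_zero hp hq hθ) hB hA

/-- **Subcritical phase**: for `0 ≤ p < p_c(q)` the finite-volume random-cluster measures on `Λ_N ↑ ℤ^d` converge to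
`φ⁰_{p,q}` on every local event WHATEVER the boundary wirings `B_N ⊆ ∂Λ_N`. [cite: Grimmett2006, remark after Thm. (5.33) (p. 107) with (4.36)] -/
theorem tendsto_rcMeasure_real_of_lt_rcCriticalProb (hq : 1 ≤ q) (hp0 : 0 ≤ p) (hlt : p < rcCriticalProb d q)
    {B : ∀ N : ℕ, Set ↥(box d N)} (hB : ∀ N, B N ⊆ boxBC d true N) {A : Set (BondConfig (Site d))}
    (hA : IsLocalEvent A) :
    Tendsto (fun N => (rcMeasure (finsetGraph (zdGraph d) (box d N)) p q (B N)).real (liftEdges (box d N) ⁻¹' A))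
      atTop (𝓝 ((rcLimit d false p q).real A)) :=
  tendsto_rcMeasure_real_of_rcLimit_eq ⟨hp0, hlt.le.trans (rcCriticalProb_mem_Icc d q).2⟩ hq
    (rcLimit_false_eq_rcLimit_true_of_lt_rcCriticalProb hq hp0 hlt) hB hA

/-- **Reading for the cell's wired target**: if `θ¹(p_c(q), q) = 0` (`FKContinuityWired d q`, the wired continuity
statement `T_W(q)`), then AT CRITICALITY the box measures converge to the unique critical state whatever the boundary
wirings — boundary-wiring insensitivity at `p_c(q)` is a CONSEQUENCE of `T_W(q)` (nothing is claimed about `T_W(q)` itself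
for `q ∈ (1,2)`). [cite: Grimmett2006, Thm. (5.33)(a) with (4.36) and Conj. (5.34)] -/
theorem tendsto_rcMeasure_real_rcCriticalProb_of_fkContinuityWired (hq : 1 ≤ q) (h : FKContinuityWired d q)
    {B : ∀ N : ℕ, Set ↥(box d N)} (hB : ∀ N, B N ⊆ boxBC d true N) {A : Set (BondConfig (Site d))}
    (hA : IsLocalEvent A) :
    Tendsto (fun N => (rcMeasure (finsetGraph (zdGraph d) (box d N)) (rcCriticalProb d q) q (B N)).real
      (liftEdges (box d N) ⁻¹' A)) atTop (𝓝 ((rcLimit d false (rcCriticalProb d q) q).real A)) :=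
  tendsto_rcMeasure_real_of_rcLimit_eq (rcCriticalProb_mem_Icc d q) hq
    (rcLimit_false_eq_rcLimit_true_of_fkContinuityWired hq h) hB hA

/-- **For all but countably many `p`** (`q ≥ 1` fixed), the finite-volume random-cluster measures on `Λ_N ↑ ℤ^d`
converge to `φ⁰_{p,q} = φ¹_{p,q}` whatever the boundary wirings `B_N ⊆ ∂Λ_N`: the exceptional set is contained in the
countable set `𝒟_q` of Thm. (4.60)/(4.63). [cite: Grimmett2006, Thm. (4.60) with (4.36)] -/
theorem countable_setOf_not_forall_wiring_tendsto {q : ℝ} (hq : 1 ≤ q) :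
    {p : ℝ | p ∈ Set.Icc (0 : ℝ) 1 ∧ ¬ ∀ B : ∀ N : ℕ, Set ↥(box d N), (∀ N, B N ⊆ boxBC d true N) →
      ∀ A : Set (BondConfig (Site d)), IsLocalEvent A →
        Tendsto (fun N => (rcMeasure (finsetGraph (zdGraph d) (box d N)) p q (B N)).real (liftEdges (box d N) ⁻¹' A))
          atTop (𝓝 ((rcLimit d false p q).real A))}.Countable := by
  refine Set.Countable.mono (fun p hp => ?_) (countable_setOf_rcLimit_false_ne_rcLimit_true (d := d) hq)
  exact ⟨hp.1, fun h => hp.2 ((rcLimit_false_eq_rcLimit_true_iff_forall_wiring hp.1 hq).1 h)⟩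

/-- **The critical FK–Ising model on `ℤ^d`, `d ≥ 3`, forgets its boundary wiring**: at `q = 2`, `p = p_c(2)`, for EVERY
sequence of wired classes `B_N ⊆ ∂Λ_N` and every local event `A`, `φ^{B_N}_{Λ_N,p_c(2),2}(A) → φ_{p_c(2),2}(A)`, the unique
critical state (`UniquenessCriticalFKIsing`, from `θ¹(p_c(2),2) = 0`, Aizenman–Duminil-Copin–Sidoravicius 2015).
[cite: Grimmett2006, (4.36) with Conj. (5.34)(ii) at q = 2] [cite: AizenmanDuminilCopinSidoraviciusCMP2015, Thm. 1.2 with Cor. 1.5 (1)] -/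
theorem tendsto_rcMeasure_real_rcCriticalProb_two (hd : 3 ≤ d) {B : ∀ N : ℕ, Set ↥(box d N)}
    (hB : ∀ N, B N ⊆ boxBC d true N) {A : Set (BondConfig (Site d))} (hA : IsLocalEvent A) :
    Tendsto (fun N => (rcMeasure (finsetGraph (zdGraph d) (box d N)) (rcCriticalProb d 2) 2 (B N)).real
      (liftEdges (box d N) ⁻¹' A)) atTop (𝓝 ((rcLimit d false (rcCriticalProb d 2) 2).real A)) :=
  tendsto_rcMeasure_real_of_rcLimit_eq (rcCriticalProb_mem_Icc d 2) (by norm_num)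
    (rcLimit_false_eq_rcLimit_true_rcCriticalProb_two hd) hB hA

/-- The same at the Edwards–Sokal parameter of the critical Ising model, `p = 1 - e^{-2β_c(d)}`, `d ≥ 3`.
[cite: Grimmett2006, (4.36) with (5.2), Thm. (5.17) eq. (5.19)] [cite: AizenmanDuminilCopinSidoraviciusCMP2015, Thm. 1.2 with Cor. 1.5 (1)] -/
theorem tendsto_rcMeasure_real_fkIsingParam_criticalBeta_two (hd : 3 ≤ d) {B : ∀ N : ℕ, Set ↥(box d N)}
    (hB : ∀ N, B N ⊆ boxBC d true N) {A : Set (BondConfig (Site d))} (hA : IsLocalEvent A) :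
    Tendsto (fun N => (rcMeasure (finsetGraph (zdGraph d) (box d N)) (fkIsingParam (criticalBeta d)) 2 (B N)).real
      (liftEdges (box d N) ⁻¹' A)) atTop (𝓝 ((rcLimit d false (fkIsingParam (criticalBeta d)) 2).real A)) := by
  rw [← rcCriticalProb_two_eq_fkIsingParam_criticalBeta (by omega)]
  exact tendsto_rcMeasure_real_rcCriticalProb_two hd hB hA

end Unique

end Summit.CriticalPhenomena.PercolationContinuityZ3.Theorems.FK

end
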